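import Summits.AtomisticToContinuum.HydrodynamicLimit.Theorems.RelayRaceLocalityNearConstantShortTimeHLGronwallTools
import HarnessLib

/-!
# Crux `NearConstantShortTimeHL` (stmt-AtomisticToContinuum-12502), line `small-tilt-domination` — discrete Gronwall with cells

Stub `gronwall_cells` of the Gronwall assembly (`stub_gronwallAssembly`, Yau's relative-entropy method): the entropy deficit `D`
(a real function of time, sign unknown, interval-integrable on `[0, t]`) satisfies, at the grid points `r_k = k · (t/ι)` (`k ≤ ι`),
the integral inequality `D(r_k) ≤ A + β ∫_0^{r_k} D`, and on each cell `∫_{r_j}^{r_{j+1}} D ≤ (t/ι) · D(r_j) + e_j` with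
nonnegative cell errors `e_j` of total mass `≤ E`. Then `D t ≤ (A + β E) e^{β t}`.

* `gronwall_cells` — the statement above. Proof: split `∫_0^{r_k} D` into cells
  (`intervalIntegral.sum_integral_adjacent_intervals`), bound each cell, absorb the errors into the constant
  (`D(r_k) ≤ (A + βE) + (β t/ι) ∑_{j<k} D(r_j)`, `k ≤ ι`), and run the discrete Gronwall lemma `discrete_gronwall_exp` on the
  nonnegative truncation `k ↦ max (D r_k) 0` extended by `0` past `k = ι`; finally `r_ι = t` and `(β t/ι) · ι = β t`.
-/

noncomputable section

namespace Summit.AtomisticToContinuum.HydrodynamicLimit.Theorems.NearConstantShortTimeHL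

open scoped BigOperators
open MeasureTheory Set Filter

/-- Grid points `k · (t/ι)` with `k ≤ ι` lie in `[[0, t]]` (for `t ≥ 0`, `ι > 0`). [folklore] -/
private theorem xh_grid_mem_uIcc {t : ℝ} {ι k : ℕ} (hι : 0 < ι) (ht : 0 ≤ t) (hk : k ≤ ι) :
    (k : ℝ) * (t / ι) ∈ Set.uIcc 0 t := by
  have hι' : (0 : ℝ) < ι := Nat.cast_pos.2 hι
  rw [Set.uIcc_of_le ht]
  refine ⟨mul_nonneg (Nat.cast_nonneg k) (div_nonneg ht hι'.le), ?_⟩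
  calc (k : ℝ) * (t / ι) ≤ ι * (t / ι) :=
        mul_le_mul_of_nonneg_right (Nat.cast_le.2 hk) (div_nonneg ht hι'.le)
    _ = t := mul_div_cancel₀ t hι'.ne'

/-- **Cell decomposition of the integral inequality.** Under the grid inequality `D(r_k) ≤ A + β ∫_0^{r_k} D` (`k ≤ ι`) and
the cell bounds `∫_{r_j}^{r_{j+1}} D ≤ (t/ι) D(r_j) + e_j` (`j < ι`, `e_j ≥ 0`, `∑ e_j ≤ E`), for every `k ≤ ι`:
`D(r_k) ≤ A + β E + (β t/ι) ∑_{j<k} D(r_j)` (split `∫_0^{r_k}` over the cells `[r_j, r_{j+1}] ⊆ [0, t]`). [folklore] -/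
private theorem xh_cells_recursion {t β A E : ℝ} {ι : ℕ} (hι : 0 < ι) (ht : 0 < t) (hβ : 0 ≤ β)
    {D : ℝ → ℝ} {e : ℕ → ℝ} (hD : IntervalIntegrable D volume 0 t)
    (he : ∀ j < ι, 0 ≤ e j) (hE : (∑ j ∈ Finset.range ι, e j) ≤ E)
    (ha : ∀ k ≤ ι, D (k * (t / ι)) ≤ A + β * ∫ x in (0 : ℝ)..(k * (t / ι)), D x)
    (hc : ∀ j < ι, (∫ x in (j * (t / ι) : ℝ)..((j + 1) * (t / ι)), D x) ≤ t / ι * D (j * (t / ι)) + e j)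
    {k : ℕ} (hk : k ≤ ι) :
    D (k * (t / ι)) ≤ A + β * E + β * (t / ι) * ∑ j ∈ Finset.range k, D (j * (t / ι)) := by
  -- split `∫_0^{r_k} D` over the cells
  have h := intervalIntegral.sum_integral_adjacent_intervals (μ := volume) (f := D)
    (a := fun j : ℕ => (j : ℝ) * (t / ι)) (n := k) fun j hj =>
      hD.mono_set (Set.uIcc_subset_uIcc (xh_grid_mem_uIcc hι ht.le ((Nat.le_of_lt hj).trans hk))
        (xh_grid_mem_uIcc hι ht.le (Nat.succ_le_of_lt (hj.trans_le hk))))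
  simp only [Nat.cast_zero, zero_mul, Nat.cast_succ] at h
  -- the cell bounds and the error budget on `range k ⊆ range ι`
  have hcell : ∀ j ∈ Finset.range k,
      (∫ x in (j * (t / ι) : ℝ)..((j + 1) * (t / ι)), D x) ≤ t / ι * D (j * (t / ι)) + e j :=
    fun j hj => hc j ((Finset.mem_range.1 hj).trans_le hk)
  have herr : (∑ j ∈ Finset.range k, e j) ≤ E :=
    (Finset.sum_le_sum_of_subset_of_nonneg (Finset.range_subset_range.2 hk)
      (fun j hj _ => he j (Finset.mem_range.1 hj))).trans hE
  calc D (k * (t / ι)) ≤ A + β * ∫ x in (0 : ℝ)..(k * (t / ι)), D x := ha k hk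
    _ = A + β * ∑ j ∈ Finset.range k, ∫ x in (j * (t / ι) : ℝ)..((j + 1) * (t / ι)), D x := by rw [← h]
    _ ≤ A + β * ∑ j ∈ Finset.range k, (t / ι * D (j * (t / ι)) + e j) :=
        add_le_add le_rfl (mul_le_mul_of_nonneg_left (Finset.sum_le_sum hcell) hβ)
    _ = A + β * (∑ j ∈ Finset.range k, e j) + β * (t / ι) * ∑ j ∈ Finset.range k, D (j * (t / ι)) := by
        rw [Finset.sum_add_distrib, ← Finset.mul_sum]
        ring
    _ ≤ A + β * E + β * (t / ι) * ∑ j ∈ Finset.range k, D (j * (t / ι)) :=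
        add_le_add (add_le_add le_rfl (mul_le_mul_of_nonneg_left herr hβ)) le_rfl

/-- **Discrete Gronwall with cells.** Let `D : ℝ → ℝ` be interval-integrable on `[0, t]` (`t > 0`), `ι > 0` a number of cells of
mesh `t/ι`, `β, A, E ≥ 0`, and `e_j ≥ 0` (`j < ι`) cell errors with `∑_{j<ι} e_j ≤ E`. If `D(r_k) ≤ A + β ∫_0^{r_k} D` at every
grid point `r_k = k (t/ι)`, `k ≤ ι`, and `∫_{r_j}^{r_{j+1}} D ≤ (t/ι) D(r_j) + e_j` on every cell `j < ι`, then
`D t ≤ (A + β E) e^{β t}` (cell decomposition `xh_cells_recursion`, then `discrete_gronwall_exp` for the nonnegative truncation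
`max (D r_k) 0` extended by zero, and `r_ι = t`). [folklore] -/
theorem gronwall_cells : ∀ {t β A E : ℝ} {ι : ℕ}, 0 < ι → 0 < t → 0 ≤ β → 0 ≤ A → 0 ≤ E →
    ∀ {D : ℝ → ℝ} {e : ℕ → ℝ}, IntervalIntegrable D MeasureTheory.volume 0 t →
    (∀ j < ι, 0 ≤ e j) → (∑ j ∈ Finset.range ι, e j) ≤ E →
    (∀ k ≤ ι, D (k * (t / ι)) ≤ A + β * ∫ x in (0 : ℝ)..(k * (t / ι)), D x) →
    (∀ j < ι, (∫ x in (j * (t / ι) : ℝ)..((j + 1) * (t / ι)), D x) ≤ t / ι * D (j * (t / ι)) + e j) →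
    D t ≤ (A + β * E) * Real.exp (β * t) := by
  intro t β A E ι hι ht hβ hA hE D e hD he hsum ha hc
  have hι' : (0 : ℝ) < ι := Nat.cast_pos.2 hι
  have hA' : 0 ≤ A + β * E := add_nonneg hA (mul_nonneg hβ hE)
  have hB : 0 ≤ β * (t / ι) := mul_nonneg hβ (div_nonneg ht.le hι'.le)
  -- the nonnegative truncation of the grid values, extended by zero past `k = ι`
  obtain ⟨a, ha_def⟩ : ∃ a : ℕ → ℝ, ∀ k, a k = if k ≤ ι then max (D (k * (t / ι))) 0 else 0 :=
    ⟨_, fun _ => rfl⟩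
  have ha0 : ∀ k, 0 ≤ a k := fun k => by
    rw [ha_def k]
    split_ifs
    · exact le_max_right _ _
    · exact le_rfl
  have hle : ∀ k ≤ ι, D (k * (t / ι)) ≤ a k := fun k hk => by
    rw [ha_def k, if_pos hk]
    exact le_max_left _ _
  -- the Gronwall recursion for `a`, valid for every `k`
  have hrec : ∀ k, a k ≤ A + β * E + β * (t / ι) * ∑ j ∈ Finset.range k, a j := by
    intro k
    have hR : 0 ≤ A + β * E + β * (t / ι) * ∑ j ∈ Finset.range k, a j :=
      add_nonneg hA' (mul_nonneg hB (Finset.sum_nonneg fun j _ => ha0 j))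
    by_cases hk : k ≤ ι
    · have h1 : D (k * (t / ι)) ≤ A + β * E + β * (t / ι) * ∑ j ∈ Finset.range k, a j :=
        (xh_cells_recursion hι ht hβ hD he hsum ha hc hk).trans
          (add_le_add le_rfl (mul_le_mul_of_nonneg_left
            (Finset.sum_le_sum fun j hj => hle j ((Finset.mem_range.1 hj).le.trans hk)) hB))
      rw [ha_def k, if_pos hk]
      exact max_le h1 hR
    · rw [ha_def k, if_neg hk]
      exact hR
  have hfin := discrete_gronwall_exp hA' hB hrec ι
  have htι : (ι : ℝ) * (t / ι) = t := mul_div_cancel₀ t hι'.ne'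
  have hexp : β * (t / ι) * ι = β * t := by rw [mul_assoc, mul_comm (t / ι), htι]
  calc D t = D (ι * (t / ι)) := by rw [htι]
    _ ≤ a ι := hle ι le_rfl
    _ ≤ (A + β * E) * Real.exp (β * (t / ι) * ι) := hfin
    _ = (A + β * E) * Real.exp (β * t) := by rw [hexp]

end Summit.AtomisticToContinuum.HydrodynamicLimit.Theorems.NearConstantShortTimeHL

end
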